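import Summits.HubbardSuperconductivity.HubbardSuperconductivity.Theorems.WidthHaldaneEnergyResponse
import Literature.MathematicalPhysics.QuantumLattice.SectorGroundProjContinuity

/-!
# The energy dual of the Haldane law is EXACT (crux `WidthHaldaneBridge`, stmt-HubbardSuperconductivity-16311)

Crux `WidthHaldaneBridge` (routes `WidthHaldane`, `SeamInduction`) concludes a POINTWISE floor on the
column `d_{x²-y²}` pair correlator `G_ψ(r) = tubeColumnPairCorr L M Λ e ψ r` of every normalised
sector ground state `ψ` of the pure tube (`HaldaneLaw`, `Theorems/WidthHaldaneDefs.lean`). Round-1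
crux ideation (cards `pair-repulsion-dual`, `frustration-cost-duality`; sketch
`Cruxes/WidthHaldaneBridge/IdeaSketchR1K1.lean`) proposed to trade the ground-state quantifier for a
statement about sector MINIMA of explicit Hermitian matrices: with the repulsive column pair source
`X_r = Σ_a (Φ_a† Φ_{a+r} + Φ_{a+r}† Φ_a)`, `Φ_a = Σ_b P_{e⁻¹(a,b)}` (`Re⟨ψ, X_r ψ⟩ = 2G_ψ(r)`), the
DUAL LAW asks, for every admissible tube and displacement, for a coupling `h > 0` with
`E₀ + h·2·floor ≤ minEnergyOn (tubeH0 + h•X_r) (sector)`, and the sketch proves dual ⇒ primal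
(variational principle). This file proves the CONVERSE, so that the dual line's single stub is the
crux itself:

* `exists_minEnergyOn_add_smul_ge_of_ground_floor` — generic FIRST-ORDER PERTURBATION FROM BELOW:
  for Hermitian `H`, `Y`, an `H`-invariant sector `K ≠ ⊥` and a floor `c > 0` of `Re⟨ψ, Yψ⟩/‖ψ‖²` on
  the sector ground multiplet of `H`, some `h > 0` has `minEnergyOn H K + h·c/2 ≤ minEnergyOn (H + h•Y) K`
  (gap above the ground multiplet, Literature `exists_gap_above_groundMultiplet`; Kato II-§6.1);
* `re_form_columnPairSource` (`Re⟨ψ, X_r ψ⟩ = 2G_ψ(r)`, dot-product form of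
  `WidthHaldaneEnergyResponse.re_expect_columnPairRepulsion`), `re_form_columnPairSource_zero_nonneg`,
  `tubeH0_mulVec_mem_szSector_tubeFilling`, `szSector_tubeFilling_ne_bot` — bookkeeping;
* `haldaneLaw_of_dualLaw` — dual `(Ξ, A, R, M₂, L₁)` ⇒ `HaldaneLaw (Ξ, A, R, M₂, L₁)` (the sketch's
  step, over the written-out source; pointwise it is `WidthHaldaneEnergyResponse.tubeColumnPairCorr_ge_of_energy_floor`);
* `dualLaw_of_haldaneLaw` — **`HaldaneLaw (Ξ, A, R, M₂, L₁)`, `A > 0`, `δ ≥ -1` ⇒ dual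
  `(Ξ, A/2, R, M₂, L₁)`** (the factor `½` is the second-order price; `r = 0` by positivity of `X_0`);
* `widthHaldaneBridge_iff_dualBridge` — **the crux ⟺ its energy dual** (registered sub-goal of
  stmt-16311): the "line" `DualBridge → WidthHaldaneBridge` and the transfer target
  `FrustrationCostBridge` (`J_r = X_r/2`) are restatements of the crux, not decompositions.

No definitions (the source `X_r` is written out; it is `IdeaSketch.pairRepulsion` unfolded). Sources
for the objects only: Haldane, PRL 47 (1981) 1840; Kato, *Perturbation Theory for Linear Operators*
(1966) II-§6.1; Tasaki (2020) §2.2. REUSED: `exists_gap_above_groundMultiplet`, `projMatrix_map_mulVec_*`,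
`minEnergyOn_le_rayleigh_of_mem`, `minEnergyOn_mul_le_re_rayleigh`, `eucNorm_mulVec_le`,
`re_expect_columnPairRepulsion`, `mem_szSector_two_mul_zero_iff`; `lean search 'minEnergyOn_add_smul_ge'`:
only the CEILING direction exists (`WidthHaldaneEnergyResponse`, `GriffithsLemmaGroundStates`) (2026-08-17).
-/

noncomputable section

namespace Summit.HubbardSuperconductivity.HubbardSuperconductivity.Theorems.WidthHaldane

set_option linter.dupNamespace false -- summit = problem name (single-conjunct summit), D-0017

open scoped BigOperators Classical Matrix ComplexConjugate Matrix.Norms.L2Operator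
open Matrix Literature.MathematicalPhysics.QuantumLattice
  Literature.MathematicalPhysics.QuantumLattice.EigenvalueContinuation
  Literature.Computability.AlgebraicComplexity
open Summit.HubbardSuperconductivity.HubbardSuperconductivity.Theses.WidthHaldane (WidthHaldaneBridge)

/-! ### A first-order LOWER bound for the sector minimum of a Hermitian pencil -/

section FirstOrder

variable {ι : Type*} [Fintype ι] [DecidableEq ι]

omit [DecidableEq ι] in
/-- A quadratic-form lower bound on a non-trivial subspace bounds its sector energy from below:
if `E ‖v‖² ≤ Re⟨v, A v⟩` for all `v ∈ K` and `K ≠ ⊥`, then `E ≤ minEnergyOn A K`. [folklore] -/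
theorem le_minEnergyOn_of_forall_form (A : Matrix ι ι ℂ) (K : Submodule ℂ (ι → ℂ)) (hK : K ≠ ⊥)
    {E : ℝ} (h : ∀ v ∈ K, E * (star v ⬝ᵥ v).re ≤ (star v ⬝ᵥ A *ᵥ v).re) : E ≤ A.minEnergyOn K := by
  classical
  obtain ⟨w, hwK, hw0⟩ := Submodule.exists_mem_ne_zero_of_ne_bot hK
  obtain ⟨c, -, -, hc1⟩ := exists_normalize hw0
  refine le_csInf ⟨_, (c : ℂ) • w, K.smul_mem (c : ℂ) hwK, hc1, rfl⟩ ?_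
  rintro _ ⟨ψ, hψ, hψ1, rfl⟩
  have := h ψ hψ
  rwa [hψ1, Complex.one_re, mul_one] at this

omit [DecidableEq ι] in
/-- Real part of a real multiple of a pairing: `Re (v⋆ · (h • w)) = h · Re (v⋆ · w)` for `h : ℝ`.
[folklore] -/
theorem re_dotProduct_real_smul (v w : ι → ℂ) (h : ℝ) :
    (star v ⬝ᵥ (h • w)).re = h * (star v ⬝ᵥ w).re := by
  rw [dotProduct_smul, Complex.smul_re, smul_eq_mul]

omit [DecidableEq ι] in
/-- The quadratic form of a real pencil member: `Re⟨v, (H + h•Y) v⟩ = Re⟨v, Hv⟩ + h·Re⟨v, Yv⟩`.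
[folklore] -/
theorem re_form_add_real_smul (H Y : Matrix ι ι ℂ) (h : ℝ) (v : ι → ℂ) :
    (star v ⬝ᵥ (H + h • Y) *ᵥ v).re = (star v ⬝ᵥ H *ᵥ v).re + h * (star v ⬝ᵥ Y *ᵥ v).re := by
  rw [add_mulVec, dotProduct_add, Complex.add_re, smul_mulVec, re_dotProduct_real_smul]

/-- `|Re⟨u, Y w⟩| ≤ ‖Y‖ ‖u‖ ‖w‖` (Cauchy–Schwarz and the operator norm). [folklore] -/
theorem abs_re_dotProduct_mulVec_le (Y : Matrix ι ι ℂ) (u w : ι → ℂ) :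
    |(star u ⬝ᵥ Y *ᵥ w).re| ≤ ‖Y‖ * eucNorm u * eucNorm w := by
  calc |(star u ⬝ᵥ Y *ᵥ w).re| ≤ ‖star u ⬝ᵥ Y *ᵥ w‖ := Complex.abs_re_le_norm _
    _ ≤ eucNorm u * eucNorm (Y *ᵥ w) := norm_star_dotProduct_le u _
    _ ≤ eucNorm u * (‖Y‖ * eucNorm w) :=
        mul_le_mul_of_nonneg_left (eucNorm_mulVec_le Y w) (eucNorm_nonneg u)
    _ = ‖Y‖ * eucNorm u * eucNorm w := by ring

/-- **First-order perturbation of a sector minimum from below.** Let `H`, `Y` be Hermitian, `K ≠ ⊥`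
an `H`-invariant sector, `e₀ = minEnergyOn H K`, and suppose the conjugate observable `Y` has a
floor `c > 0` on the sector ground multiplet: `c ‖ψ‖² ≤ Re⟨ψ, Yψ⟩` for every `ψ ∈ K` with
`Hψ = e₀ψ`. Then for some coupling `h > 0` the perturbed sector minimum has risen by at least half
the first-order amount: `e₀ + h·c/2 ≤ minEnergyOn (H + h•Y) K`. (Split `v = p + w` along the ground
multiplet and its orthogonal complement in `K`; `w` feels the gap `g > 0` above `e₀`
(`exists_gap_above_groundMultiplet`), `p` feels the floor, the cross term is `≤ 2h‖Y‖‖p‖‖w‖`; with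
`h(c + ‖Y‖) ≤ g/2` and `h‖Y‖² ≤ gc/4` the quadratic form in `(‖p‖, ‖w‖)` is nonnegative.) The converse
of the Feynman–Hellmann supergradient inequality `minEnergyOn_pencil_le_of_ground`. Kato (1966)
II-§6.1. [folklore] -/
theorem exists_minEnergyOn_add_smul_ge_of_ground_floor {H Y : Matrix ι ι ℂ} (hH : H.IsHermitian)
    (hY : Y.IsHermitian) (K : Submodule ℂ (ι → ℂ)) (hK : K ≠ ⊥) (hKH : ∀ v ∈ K, H *ᵥ v ∈ K)
    {c : ℝ} (hc : 0 < c)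
    (hfloor : ∀ ψ ∈ K, H *ᵥ ψ = ((H.minEnergyOn K : ℝ) : ℂ) • ψ →
      c * (star ψ ⬝ᵥ ψ).re ≤ (star ψ ⬝ᵥ Y *ᵥ ψ).re) :
    ∃ h : ℝ, 0 < h ∧ H.minEnergyOn K + h * (c / 2) ≤ (H + h • Y).minEnergyOn K := by
  classical
  obtain ⟨g, hg, hgap⟩ := exists_gap_above_groundMultiplet hH K hKH
  set m : ℝ := H.minEnergyOn K with hm_def
  set B : ℝ := ‖Y‖ with hB_def
  have hB : 0 ≤ B := norm_nonneg _
  -- the coupling: `h (c + B) ≤ g/2` and `h B² ≤ g c/4`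
  obtain ⟨h, hh, hh1, hh2⟩ : ∃ h : ℝ, 0 < h ∧ h * (c + B) ≤ g / 2 ∧ h * B ^ 2 ≤ g * c / 4 := by
    have hD : (0 : ℝ) < 2 * c * (c + B) + 4 * B ^ 2 + 1 := by positivity
    refine ⟨g * c / (2 * c * (c + B) + 4 * B ^ 2 + 1), by positivity, ?_, ?_⟩
    · rw [div_mul_eq_mul_div, div_le_iff₀ hD]
      nlinarith [mul_nonneg hg.le hB, mul_nonneg (mul_nonneg hg.le hc.le) hB, sq_nonneg B,
        mul_nonneg hg.le (sq_nonneg B), hg, hc]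
    · rw [div_mul_eq_mul_div, div_le_div_iff₀ hD (by norm_num : (0 : ℝ) < 4)]
      nlinarith [mul_nonneg (mul_nonneg hg.le hc.le) (show (0 : ℝ) ≤ 2 * c * (c + B) + 1 by positivity)]
  refine ⟨h, hh, le_minEnergyOn_of_forall_form _ K hK fun v hv => ?_⟩
  -- the ground multiplet `E` and the projection onto it
  set E : Submodule ℂ (ι → ℂ) := K ⊓ Module.End.eigenspace (Matrix.toLin' H) (m : ℂ) with hE_def
  set P : Matrix ι ι ℂ := projMatrix (E.map
    ((WithLp.linearEquiv 2 ℂ (ι → ℂ)).symm : (ι → ℂ) →ₗ[ℂ] EuclideanSpace ℂ ι)) with hP_def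
  have hPh : P.IsHermitian := projMatrix_isHermitian _
  have hmemE : ∀ ψ, ψ ∈ E ↔ ψ ∈ K ∧ H *ᵥ ψ = (m : ℂ) • ψ := fun ψ =>
    mem_inf_eigenspace_toLin'_iff H K m ψ
  -- `p = P v ∈ E`, `w = v - p ∈ K ∩ E^⊥`
  set p : ι → ℂ := P *ᵥ v with hp_def
  set w : ι → ℂ := v - p with hw_def
  have hpE : p ∈ E := projMatrix_map_mulVec_mem E v
  obtain ⟨hpK, hHp⟩ := (hmemE p).1 hpE
  have hwK : w ∈ K := K.sub_mem hv hpK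
  have hPψ : ∀ ψ ∈ E, star ψ ⬝ᵥ p = star ψ ⬝ᵥ v := by
    intro ψ hψ
    have hfix : P *ᵥ ψ = ψ := projMatrix_map_mulVec_of_mem E hψ
    rw [hp_def]
    conv_rhs => rw [← hfix]
    rw [star_mulVec, hPh.eq, ← dotProduct_mulVec]
  have hworth : ∀ ψ ∈ K, H *ᵥ ψ = (m : ℂ) • ψ → star ψ ⬝ᵥ w = 0 := by
    intro ψ hψK hψ
    rw [hw_def, dotProduct_sub, hPψ ψ ((hmemE ψ).2 ⟨hψK, hψ⟩), sub_self]
  have hgapw := hgap w hwK hworth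
  have hpw : star p ⬝ᵥ w = 0 := hworth p hpK hHp
  have hwp : star w ⬝ᵥ p = 0 := by rw [star_dotProduct, hpw, star_zero]
  have hwHp : star w ⬝ᵥ H *ᵥ p = 0 := by rw [hHp, dotProduct_smul, hwp, smul_zero]
  have hpHw : star p ⬝ᵥ H *ᵥ w = 0 := by
    rw [star_dotProduct_mulVec_comm hH.eq, hwHp, star_zero]
  have hv_eq : v = p + w := by rw [hw_def, add_sub_cancel]
  -- the `H`-form and the norm split
  have h1 : star v ⬝ᵥ H *ᵥ v = (m : ℂ) * (star p ⬝ᵥ p) + star w ⬝ᵥ H *ᵥ w := by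
    conv_lhs => rw [hv_eq]
    rw [mulVec_add, star_add, add_dotProduct, dotProduct_add, dotProduct_add, hpHw, hwHp,
      hHp, dotProduct_smul, smul_eq_mul]
    ring
  have h2 : star v ⬝ᵥ v = star p ⬝ᵥ p + star w ⬝ᵥ w := by
    conv_lhs => rw [hv_eq]
    rw [star_add, add_dotProduct, dotProduct_add, dotProduct_add, hpw, hwp]
    ring
  -- the `Y`-form split: `⟨v, Yv⟩ = ⟨p, Yp⟩ + ⟨p, Yw⟩ + ⟨w, Yp⟩ + ⟨w, Yw⟩`, middle terms conjugate
  have h3 : (star v ⬝ᵥ Y *ᵥ v).re =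
      (star p ⬝ᵥ Y *ᵥ p).re + 2 * (star p ⬝ᵥ Y *ᵥ w).re + (star w ⬝ᵥ Y *ᵥ w).re := by
    have hconj : (star w ⬝ᵥ Y *ᵥ p).re = (star p ⬝ᵥ Y *ᵥ w).re := by
      rw [star_dotProduct_mulVec_comm hY.eq, Complex.star_def, Complex.conj_re]
    conv_lhs => rw [hv_eq]
    rw [mulVec_add, star_add, add_dotProduct, dotProduct_add, dotProduct_add]
    simp only [Complex.add_re]
    rw [hconj]
    ring
  -- the four estimates
  have hfl : c * (star p ⬝ᵥ p).re ≤ (star p ⬝ᵥ Y *ᵥ p).re := hfloor p hpK hHp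
  have hcross : |(star p ⬝ᵥ Y *ᵥ w).re| ≤ B * eucNorm p * eucNorm w :=
    abs_re_dotProduct_mulVec_le Y p w
  have hww : |(star w ⬝ᵥ Y *ᵥ w).re| ≤ B * eucNorm w * eucNorm w :=
    abs_re_dotProduct_mulVec_le Y w w
  have hpp : (star p ⬝ᵥ p).re = eucNorm p ^ 2 := (eucNorm_sq p).symm
  have hwwn : (star w ⬝ᵥ w).re = eucNorm w ^ 2 := (eucNorm_sq w).symm
  have hp0 : 0 ≤ eucNorm p := eucNorm_nonneg p
  have hw0 : 0 ≤ eucNorm w := eucNorm_nonneg w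
  -- assemble
  rw [re_form_add_real_smul, h2, Complex.add_re, hpp, hwwn]
  have h1re : (star v ⬝ᵥ H *ᵥ v).re = m * eucNorm p ^ 2 + (star w ⬝ᵥ H *ᵥ w).re := by
    rw [h1, Complex.add_re, Complex.re_ofReal_mul, hpp]
  rw [h1re, h3]
  rw [hwwn] at hgapw
  have hcr := (abs_le.1 hcross).1
  have hwr := (abs_le.1 hww).1
  rw [hpp] at hfl
  -- the quadratic form `(hc/2) s² + (g - h(c/2 + B)) t² - 2hB s t ≥ 0`, `s = ‖p‖`, `t = ‖w‖`
  set s := eucNorm p with hs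
  set t := eucNorm w with ht
  have key : 0 ≤ h * c / 2 * s ^ 2 + (g - h * (c / 2 + B)) * t ^ 2 - 2 * h * B * s * t := by
    have hA : 0 < h * c / 2 := by positivity
    have hdet : (h * B) ^ 2 ≤ h * c / 2 * (g - h * (c / 2 + B)) := by
      nlinarith [hh1, hh2, hh.le, hc.le, hB]
    nlinarith [sq_nonneg (h * c / 2 * s - h * B * t), hdet, sq_nonneg t, hA]
  nlinarith [key, hfl, hcr, hwr, hgapw, hh.le, hB, hp0, hw0, mul_nonneg hp0 hw0]

end FirstOrder

/-! ### The column pair source of the tube and the column correlator -/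

section Tube

variable (L M : ℕ) [NeZero L] [NeZero M] (Λ : Type) [LinearOrder Λ] [Fintype Λ]
  (e : Λ ≃ ZMod L × ZMod M)

/-- **`Re⟨ψ, X_r ψ⟩ = 2·G_ψ(r)`** for the column pair source
`X_r = Σ_a (Φ_a† Φ_{a+r} + Φ_{a+r}† Φ_a)`, `Φ_a = Σ_b P_{e⁻¹(a,b)}` (written out), and the column
pair correlator `G_ψ = tubeColumnPairCorr` — the dot-product form of
`re_expect_columnPairRepulsion`. [folklore] -/
theorem re_form_columnPairSource (ψ : Fock (Orb Λ)) (r : ZMod L) :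
    (star ψ ⬝ᵥ (∑ a : ZMod L, ((∑ b : ZMod M, tubeDWavePair L M Λ e (e.symm (a, b)))ᴴ * (∑ b : ZMod M, tubeDWavePair L M Λ e (e.symm (a + r, b))) + (∑ b : ZMod M, tubeDWavePair L M Λ e (e.symm (a + r, b)))ᴴ * (∑ b : ZMod M, tubeDWavePair L M Λ e (e.symm (a, b))))) *ᵥ ψ).re = 2 * tubeColumnPairCorr L M Λ e ψ r := by
  rw [← re_expect_columnPairRepulsion L M Λ e ψ r, expect]

/-- At displacement `r = 0` the source is nonnegative in every vector:
`Re⟨ψ, X_0 ψ⟩ = 2G_ψ(0) = 2Σ_a ‖Φ_a ψ‖² ≥ 0`. [folklore] -/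
theorem re_form_columnPairSource_zero_nonneg (ψ : Fock (Orb Λ)) :
    0 ≤ (star ψ ⬝ᵥ (∑ a : ZMod L, ((∑ b : ZMod M, tubeDWavePair L M Λ e (e.symm (a, b)))ᴴ * (∑ b : ZMod M, tubeDWavePair L M Λ e (e.symm (a + 0, b))) + (∑ b : ZMod M, tubeDWavePair L M Λ e (e.symm (a + 0, b)))ᴴ * (∑ b : ZMod M, tubeDWavePair L M Λ e (e.symm (a, b))))) *ᵥ ψ).re := by
  rw [re_form_columnPairSource]
  exact mul_nonneg zero_le_two (tubeColumnPairCorr_zero_nonneg L M Λ e ψ)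

omit [NeZero L] [NeZero M] in
/-- The pure tube maps the cruxes' sector `(N_{L,M}(δ), S^z = 0)` into itself (it conserves `N↑`,
`N↓`; the filling is even by construction). [folklore] -/
theorem tubeH0_mulVec_mem_szSector_tubeFilling (U δ : ℝ) {v : Fock (Orb Λ)}
    (hv : v ∈ szSector (tubeFilling L M δ) 0) : tubeH0 L M Λ e U *ᵥ v ∈ szSector (tubeFilling L M δ) 0 := by
  have hv' := (mem_szSector_two_mul_zero_iff _ v).1 hv
  exact (mem_szSector_two_mul_zero_iff _ _).2
    ((LiebThm1.preservesSectors_hamiltonian (tubeGraph e) 1 U).isInSector_mulVec hv')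

include e in
/-- The cruxes' sector is non-trivial for `δ ≥ -1` (it contains a ground state). [folklore] -/
theorem szSector_tubeFilling_ne_bot (U : ℝ) {δ : ℝ} (hδ : -1 ≤ δ) :
    (szSector (tubeFilling L M δ) 0 : Submodule ℂ (Fock (Orb Λ))) ≠ ⊥ := by
  obtain ⟨ψ, -, hψ⟩ := exists_unit_isGroundStateInSector_tubeH0_tubeFilling L M Λ e U hδ
  exact (Submodule.ne_bot_iff _).2 ⟨ψ, hψ.1, hψ.2.1⟩

end Tube

/-! ### The dual (energy) law ⇒ the Haldane law, same constants -/

/-- **Dual ⇒ primal (the ideator's transfer step, over the written-out source).** If for every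
admissible tube and displacement some repulsive coupling `h > 0` of the column pair source raises the
sector minimum by at least `h · 2·floor`, then every normalised sector ground state has
`floor ≤ G_ψ(r)`: price the ground state in the perturbed tube (variational principle) and use
`Re⟨ψ, X_r ψ⟩ = 2G_ψ(r)`. [folklore] -/
theorem haldaneLaw_of_dualLaw {U δ Ξ A : ℝ} {R M₂ L₁ : ℕ}
    (hdual :
    ∀ (L M : ℕ) [NeZero L] [NeZero M], Even L → Even M → M₂ ≤ M → M ≤ L → L₁ ≤ L →
      ∀ (Λ : Type) [LinearOrder Λ] [Fintype Λ] (e : Λ ≃ ZMod L × ZMod M) (r : ZMod L),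
        R ≤ r.val → r.val + R ≤ L →
          ∃ h : ℝ, 0 < h ∧
            (tubeH0 L M Λ e U).minEnergyOn (szSector (tubeFilling L M δ) 0) +
                h * (2 * (A * (L : ℝ) * (M : ℝ) ^ 2 * ((min r.val (L - r.val) : ℕ) : ℝ) ^ (-(Ξ * Real.sqrt (tubePairCompressibility L M Λ e U δ / tubeStiffness L M Λ e U δ) / (M : ℝ))))) ≤
              (tubeH0 L M Λ e U + h • (∑ a : ZMod L, ((∑ b : ZMod M, tubeDWavePair L M Λ e (e.symm (a, b)))ᴴ * (∑ b : ZMod M, tubeDWavePair L M Λ e (e.symm (a + r, b))) + (∑ b : ZMod M, tubeDWavePair L M Λ e (e.symm (a + r, b)))ᴴ * (∑ b : ZMod M, tubeDWavePair L M Λ e (e.symm (a, b)))))).minEnergyOn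
                (szSector (tubeFilling L M δ) 0)) :
    HaldaneLaw U δ Ξ A R M₂ L₁ := by
  intro L M _ _ hLe hMe hM hML hL Λ _ _ e ψ hψ hGS r hr hrL
  obtain ⟨h0, hh0, hE⟩ := hdual L M hLe hMe hM hML hL Λ e r hr hrL
  obtain ⟨hmem, -, hHψ⟩ := hGS
  have hHerm := (isHermitian_tubeH0 L M Λ e U).add
    ((isHermitian_columnPairRepulsion L M Λ e r).smul (IsSelfAdjoint.all h0))
  have hvar := minEnergyOn_le_rayleigh_of_mem hHerm (szSector (tubeFilling L M δ) 0) hmem hψ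
  rw [re_form_add_real_smul, hHψ, dotProduct_smul, hψ, re_form_columnPairSource] at hvar
  simp only [smul_eq_mul, mul_one, Complex.ofReal_re] at hvar
  nlinarith

/-! ### The Haldane law ⇒ the dual law with half the amplitude -/

/-- **Primal ⇒ dual.** The Haldane law with constants `(Ξ, A, R, M₂, L₁)`, `A > 0`, at any
`δ ≥ -1`, implies the dual energy law with constants `(Ξ, A/2, R, M₂, L₁)`: for every admissible tube
and displacement some `h > 0` makes the column pair source cost at least `h · A·L·M²·r̂^{-x}` of
sector energy. First-order perturbation from below (`exists_minEnergyOn_add_smul_ge_of_ground_floor`)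
with the floor `2·A·L·M²·r̂^{-x}` that the law puts on `Re⟨ψ, X_r ψ⟩ = 2G_ψ(r)` over the ground
multiplet; the degenerate instance `r̂^{-x} = 0` (only `r = 0`) is the positivity of `X_0`.
[folklore] -/
theorem dualLaw_of_haldaneLaw {U δ Ξ A : ℝ} {R M₂ L₁ : ℕ} (hδ : -1 ≤ δ) (hA : 0 < A)
    (hlaw : HaldaneLaw U δ Ξ A R M₂ L₁) :
    ∀ (L M : ℕ) [NeZero L] [NeZero M], Even L → Even M → M₂ ≤ M → M ≤ L → L₁ ≤ L →
      ∀ (Λ : Type) [LinearOrder Λ] [Fintype Λ] (e : Λ ≃ ZMod L × ZMod M) (r : ZMod L),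
        R ≤ r.val → r.val + R ≤ L →
          ∃ h : ℝ, 0 < h ∧
            (tubeH0 L M Λ e U).minEnergyOn (szSector (tubeFilling L M δ) 0) +
                h * (2 * ((A / 2) * (L : ℝ) * (M : ℝ) ^ 2 * ((min r.val (L - r.val) : ℕ) : ℝ) ^ (-(Ξ * Real.sqrt (tubePairCompressibility L M Λ e U δ / tubeStiffness L M Λ e U δ) / (M : ℝ))))) ≤
              (tubeH0 L M Λ e U + h • (∑ a : ZMod L, ((∑ b : ZMod M, tubeDWavePair L M Λ e (e.symm (a, b)))ᴴ * (∑ b : ZMod M, tubeDWavePair L M Λ e (e.symm (a + r, b))) + (∑ b : ZMod M, tubeDWavePair L M Λ e (e.symm (a + r, b)))ᴴ * (∑ b : ZMod M, tubeDWavePair L M Λ e (e.symm (a, b)))))).minEnergyOn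
                (szSector (tubeFilling L M δ) 0) := by
  intro L M _ _ hLe hMe hM hML hL Λ _ _ e r hr hrL
  have hK := szSector_tubeFilling_ne_bot L M Λ e U hδ
  have hH := isHermitian_tubeH0 L M Λ e U
  have hY := isHermitian_columnPairRepulsion L M Λ e r
  set fl : ℝ := A * (L : ℝ) * (M : ℝ) ^ 2 * ((min r.val (L - r.val) : ℕ) : ℝ) ^ (-(Ξ * Real.sqrt (tubePairCompressibility L M Λ e U δ / tubeStiffness L M Λ e U δ) / (M : ℝ))) with hfl_def
  have hfl0 : 0 ≤ fl := by
    have : (0 : ℝ) ≤ ((min r.val (L - r.val) : ℕ) : ℝ) := Nat.cast_nonneg _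
    positivity
  have hhalf : 2 * ((A / 2) * (L : ℝ) * (M : ℝ) ^ 2 * ((min r.val (L - r.val) : ℕ) : ℝ) ^ (-(Ξ * Real.sqrt (tubePairCompressibility L M Λ e U δ / tubeStiffness L M Λ e U δ) / (M : ℝ)))) = fl := by
    rw [hfl_def]; ring
  rw [hhalf]
  rcases hfl0.lt_or_eq with hpos | hzero
  · -- generic first-order bound with floor `2 fl` on `Re⟨ψ, X_r ψ⟩` over the ground multiplet
    have hfloor : ∀ ψ ∈ szSector (tubeFilling L M δ) 0,
        tubeH0 L M Λ e U *ᵥ ψ =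
          (((tubeH0 L M Λ e U).minEnergyOn (szSector (tubeFilling L M δ) 0) : ℝ) : ℂ) • ψ →
        2 * fl * (star ψ ⬝ᵥ ψ).re ≤ (star ψ ⬝ᵥ (∑ a : ZMod L, ((∑ b : ZMod M, tubeDWavePair L M Λ e (e.symm (a, b)))ᴴ * (∑ b : ZMod M, tubeDWavePair L M Λ e (e.symm (a + r, b))) + (∑ b : ZMod M, tubeDWavePair L M Λ e (e.symm (a + r, b)))ᴴ * (∑ b : ZMod M, tubeDWavePair L M Λ e (e.symm (a, b))))) *ᵥ ψ).re := by
      intro ψ hψK hψ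
      by_cases hψ0 : ψ = 0
      · simp [hψ0]
      obtain ⟨c, hc, hcc, hc1⟩ := exists_normalize hψ0
      have hGS : IsGroundStateInSector (tubeH0 L M Λ e U) (tubeFilling L M δ) 0 ((c : ℂ) • ψ) :=
        ⟨Submodule.smul_mem _ _ hψK, smul_ne_zero (by exact_mod_cast hc.ne') hψ0,
          by rw [mulVec_smul, hψ, smul_comm]⟩
      have key := hlaw L M hLe hMe hM hML hL Λ e ((c : ℂ) • ψ) hc1 hGS r hr hrL
      have hform := re_form_columnPairSource L M Λ e ((c : ℂ) • ψ) r
      rw [mulVec_smul, star_real_smul_dotProduct_real_smul, Complex.re_ofReal_mul] at hform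
      -- `c² Re⟨ψ, Xψ⟩ = 2 G_{cψ}(r) ≥ 2 fl` and `c² ‖ψ‖² = 1`
      have h1 : 2 * fl ≤ c * c * (star ψ ⬝ᵥ (∑ a : ZMod L, ((∑ b : ZMod M, tubeDWavePair L M Λ e (e.symm (a, b)))ᴴ * (∑ b : ZMod M, tubeDWavePair L M Λ e (e.symm (a + r, b))) + (∑ b : ZMod M, tubeDWavePair L M Λ e (e.symm (a + r, b)))ᴴ * (∑ b : ZMod M, tubeDWavePair L M Λ e (e.symm (a, b))))) *ᵥ ψ).re := by
        rw [hform]; linarith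
      have hpos' : 0 < (star ψ ⬝ᵥ ψ).re := re_star_dotProduct_self_pos hψ0
      calc 2 * fl * (star ψ ⬝ᵥ ψ).re
          ≤ c * c * (star ψ ⬝ᵥ (∑ a : ZMod L, ((∑ b : ZMod M, tubeDWavePair L M Λ e (e.symm (a, b)))ᴴ * (∑ b : ZMod M, tubeDWavePair L M Λ e (e.symm (a + r, b))) + (∑ b : ZMod M, tubeDWavePair L M Λ e (e.symm (a + r, b)))ᴴ * (∑ b : ZMod M, tubeDWavePair L M Λ e (e.symm (a, b))))) *ᵥ ψ).re * (star ψ ⬝ᵥ ψ).re :=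
            mul_le_mul_of_nonneg_right h1 hpos'.le
        _ = (star ψ ⬝ᵥ (∑ a : ZMod L, ((∑ b : ZMod M, tubeDWavePair L M Λ e (e.symm (a, b)))ᴴ * (∑ b : ZMod M, tubeDWavePair L M Λ e (e.symm (a + r, b))) + (∑ b : ZMod M, tubeDWavePair L M Λ e (e.symm (a + r, b)))ᴴ * (∑ b : ZMod M, tubeDWavePair L M Λ e (e.symm (a, b))))) *ᵥ ψ).re * (c * c * (star ψ ⬝ᵥ ψ).re) := by ring
        _ = _ := by rw [hcc, mul_one]
    obtain ⟨h, hh, hbound⟩ := exists_minEnergyOn_add_smul_ge_of_ground_floor hH hY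
      (szSector (tubeFilling L M δ) 0) hK
      (fun v hv => tubeH0_mulVec_mem_szSector_tubeFilling L M Λ e U δ hv) (by positivity) hfloor
    refine ⟨h, hh, ?_⟩
    have : h * (2 * fl / 2) = h * fl := by ring
    linarith
  · -- degenerate floor: `r̂^(-x) = 0`, hence `r = 0` and `X_0 ≥ 0`
    have hr0 : r = 0 := by
      have hx : ((min r.val (L - r.val) : ℕ) : ℝ) ^
          (-(Ξ * Real.sqrt (tubePairCompressibility L M Λ e U δ / tubeStiffness L M Λ e U δ) / (M : ℝ))) = 0 := by
        have hLM : (0 : ℝ) < A * (L : ℝ) * (M : ℝ) ^ 2 := by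
          have hL0 : (0 : ℝ) < L := Nat.cast_pos.2 (NeZero.pos L)
          have hM0 : (0 : ℝ) < M := Nat.cast_pos.2 (NeZero.pos M)
          positivity
        have := hzero
        rw [hfl_def] at this
        rcases mul_eq_zero.1 this.symm with h1 | h1
        · exact absurd h1 hLM.ne'
        · exact h1
      have hbase := ((Real.rpow_eq_zero_iff_of_nonneg (Nat.cast_nonneg _)).1 hx).1
      have hmin : min r.val (L - r.val) = 0 := by exact_mod_cast hbase
      have hrv : r.val = 0 := by
        have := r.val_lt; omega
      exact (ZMod.val_eq_zero r).1 hrv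
    subst hr0
    refine ⟨1, one_pos, ?_⟩
    rw [← hzero, mul_zero, add_zero, one_smul]
    refine le_minEnergyOn_of_forall_form _ _ hK fun v hv => ?_
    rw [add_mulVec, dotProduct_add, Complex.add_re]
    have h1 := minEnergyOn_mul_le_re_rayleigh hH (szSector (tubeFilling L M δ) 0) hv
    have h2 := re_form_columnPairSource_zero_nonneg L M Λ e v
    linarith

/-! ### The crux is equivalent to its energy dual -/

/-- **`WidthHaldaneBridge` ⟺ its energy dual** (stmt-HubbardSuperconductivity-16311). The Bridge —
width-uniform thermodynamics ⇒ a Haldane-form floor `A·L·M²·r̂^{-Ξ√(ẽ″/ρ̃)/M} ≤ G_ψ(r)` on the column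
pair correlator of EVERY sector ground state — holds iff the same hypothesis yields, for every
admissible tube and displacement, a coupling `h > 0` at which the repulsive column pair source
`h·X_r` raises the `(N_{L,M}(δ), S^z = 0)` sector MINIMUM by at least `h·2A·L·M²·r̂^{-Ξ√(ẽ″/ρ̃)/M}`
(only sector minima of explicit Hermitian matrices, no eigenvector quantifier). Hence the one-stub
"line" `DualBridge → WidthHaldaneBridge` (crux-ideate r1 k1, `Cruxes/WidthHaldaneBridge/IdeaSketchR1K1.lean`)
and the transfer target `FrustrationCostBridge` of card `frustration-cost-duality` (its `J_r` is `X_r/2`)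
are restatements of the crux, not decompositions of it. [folklore] -/
theorem widthHaldaneBridge_iff_dualBridge :
    WidthHaldaneBridge ↔
      ∀ U : ℝ, 0 < U → ∀ δ ∈ Set.Ioo (0 : ℝ) (3 / 10), ∀ (d₀ k₀ : ℝ) (M₁ L₀ : ℕ), 0 < d₀ →
        UniformThermo U δ d₀ k₀ M₁ L₀ →
          ∃ Ξ : ℝ, 0 < Ξ ∧ ∃ A : ℝ, 0 < A ∧ ∃ R M₂ L₁ : ℕ,
            ∀ (L M : ℕ) [NeZero L] [NeZero M], Even L → Even M → M₂ ≤ M → M ≤ L → L₁ ≤ L →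
              ∀ (Λ : Type) [LinearOrder Λ] [Fintype Λ] (e : Λ ≃ ZMod L × ZMod M) (r : ZMod L),
                R ≤ r.val → r.val + R ≤ L →
                  ∃ h : ℝ, 0 < h ∧
                    (tubeH0 L M Λ e U).minEnergyOn (szSector (tubeFilling L M δ) 0) +
                        h * (2 * (A * (L : ℝ) * (M : ℝ) ^ 2 * ((min r.val (L - r.val) : ℕ) : ℝ) ^ (-(Ξ * Real.sqrt (tubePairCompressibility L M Λ e U δ / tubeStiffness L M Λ e U δ) / (M : ℝ))))) ≤
                      (tubeH0 L M Λ e U + h • (∑ a : ZMod L, ((∑ b : ZMod M, tubeDWavePair L M Λ e (e.symm (a, b)))ᴴ * (∑ b : ZMod M, tubeDWavePair L M Λ e (e.symm (a + r, b))) + (∑ b : ZMod M, tubeDWavePair L M Λ e (e.symm (a + r, b)))ᴴ * (∑ b : ZMod M, tubeDWavePair L M Λ e (e.symm (a, b)))))).minEnergyOn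
                        (szSector (tubeFilling L M δ) 0) := by
  rw [widthHaldaneBridge_iff]
  constructor
  · intro hB U hU δ hδ d₀ k₀ M₁ L₀ hd₀ hth
    obtain ⟨Ξ, hΞ, A, hA, R, M₂, L₁, hlaw⟩ := hB U hU δ hδ d₀ k₀ M₁ L₀ hd₀ hth
    exact ⟨Ξ, hΞ, A / 2, by positivity, R, M₂, L₁,
      dualLaw_of_haldaneLaw (by linarith [hδ.1]) hA hlaw⟩
  · intro hD U hU δ hδ d₀ k₀ M₁ L₀ hd₀ hth
    obtain ⟨Ξ, hΞ, A, hA, R, M₂, L₁, hdual⟩ := hD U hU δ hδ d₀ k₀ M₁ L₀ hd₀ hth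
    exact ⟨Ξ, hΞ, A, hA, R, M₂, L₁, haldaneLaw_of_dualLaw hdual⟩

end Summit.HubbardSuperconductivity.HubbardSuperconductivity.Theorems.WidthHaldane

end
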